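import Summits.QuantumFields.GaugeBoot.StrongCouplingPlaquetteSU3ThirdPieces
import Summits.QuantumFields.GaugeBoot.StrongCouplingPlaquetteSUN
import HarnessLib

/-!
# Strong coupling from the loop equation, VI: THE SECOND STRONG-COUPLING COEFFICIENT OF THE `SU(3)` PLAQUETTE, `⟨ū_P⟩ = β/18 + β²/216 + O(β³)` (gauge-boot, ADDENDUM 24)

HONEST FRAMING (cell `pub-gaugeboot`, page 1 of every file): the venture produces certified bounds
on lattice expectations at stated coupling, gauge group, dimension and torus size; NOT a mass gap,
NOT a continuum limit, NOT a string tension; NOT Yang–Mills-summit-bearing (barriers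
`FixedCouplingUltralocality`, `PerturbativeInvisibility`).  An analytic STRONG-COUPLING statement with explicit,
volume-independent (crude) constants, valid for every torus side `L ≥ 2` and every real coupling; informative only for
`β_std ≲ 10⁻³` and certifying no number of CERTIFIED.md (whose couplings are `β_std ≥ 1`).

## Content (`SU(3)`, fundamental representation, torus `(ℤ/L)^d`, `d ≥ 2`, `L ≥ 2`)

Three loop-equation steps.  With tree coupling `β = β_std/3`, `τ = E[tr U_P]`, `τ̄ = E[tr U_P⁻¹]`, `a = E[(tr U_P)²]`,
`b = E[tr U_P²]`, `m = E|tr U_P|²`, the plaquette equation `(8/3)τ + (β/2)(T₀ + Σ'T) = 0`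
(`T₀ = b − 3 − (a − m)/3`), the spectator identities `(7/3)a + b = −(β/2)S₁`, `3m − 3 = −(β/2)S₃`
(`StrongCouplingDoublePlaquette`) and Cayley–Hamilton `b = a − 2τ̄` give the EXACT identity
`τ − β/2 − β²/8 = (3/10)β(τ̄ − β/2) + (3/160)β²(S₁ + 4/3) + (β²/96)S₃ − (3/16)β·Σ'T`
(`integral_trace_sub_eq_su3`), every bracket being `O(β²)`: `Re τ̄ = Re τ = 3⟨ū_P⟩ = β/2 + O(β²)` (ADDENDUM 22),
`S₁ + 4/3, S₃ = O(β)` (`StrongCouplingPlaquetteSU3ThirdPieces`: the baryon vertex `E[(tr U_P)³] = 1 + O(β)`),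
`Σ'T = O(β²)` (`StrongCouplingThirdOrderPieces`).  Result:

* ★★★ `abs_wilsonExpectation_meanPlaquette_su3_third_le` — for `d ≥ 2`, EVERY `L ≥ 2`, EVERY real tree coupling `β`:
  **`|⟨ū_P⟩_{β,L} − β/6 − β²/24| ≤ (27/8)·d²(d−1)·|β|³`**;
* ★★★ `abs_plaquetteExpectation_su3_third_le` — the cell's form: **`|plaquetteExpectation 3 D L β_std − β_std/18 − β_std²/216|
  ≤ D²(D−1)|β_std|³/8`**; `T4` (`D = 4`): `≤ 6|β_std|³`; `T3` (`D = 3`): `≤ 9|β_std|³/4` — the SECOND coefficient `1/216`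
  of the strong-coupling series of the `SU(3)` plaquette (Balian–Drouffe–Itzykson 1975; `u = β/18 + β²/216 + …`) as a theorem
  with an explicit, volume-uniform remainder, for every torus.  The coefficient is the `SU(3)` baryon vertex
  `∫_{SU(3)}(tr U)³ dU = 1`; it is absent for `SU(2)` and `U(N)`.

References: R. Balian, J.-M. Drouffe, C. Itzykson, Phys. Rev. D 11 (1975) 2104, and D 19 (1979) 2514 (E) (strong-coupling
series); Yu. Makeenko, *Methods of contemporary gauge theory* (2002) Problem 12.7; M. Creutz, *Quarks, gluons and lattices*
(1983) Ch. 8; I. Montvay, G. Münster, *Quantum fields on a lattice* (1994) §3.4.  Everything is `[folklore]`.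
-/

noncomputable section

open MeasureTheory Filter Topology NormedSpace
open scoped Matrix.Norms.Frobenius Matrix ComplexConjugate
open Literature.MathematicalPhysics.QuantumFieldTheory Literature.MathematicalPhysics.QuantumLattice
open Summit.QuantumFields.YangMills.Cruxes.CurvatureAmnesia.WardDefect.SchwingerDyson

namespace Summit.QuantumFields.GaugeBoot

namespace StrongCoupling

variable {d L : ℕ} [NeZero L]

/-! ## The exact third-order identity -/

/-- ★★ **The exact identity behind the third order** (`SU(3)`, every `L ≥ 2`, every real `β`, `μ ≠ ν₀`): with
`τ = E[tr U_P]`, `τ̄ = E[tr U_P⁻¹]`, `S₁ = ΣΣE[plaqTerm(P̃₀)·tr U_P]`, `S₃ = ΣΣE[plaqTerm(P̃₀)·tr U_P⁻¹]` and `Σ'T` the sum of the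
deformed-plaquette terms over `(ν, ε) ≠ (ν₀, +)`:
`τ − β/2 − β²/8 = (3/10)β(τ̄ − β/2) + (3/160)β²(S₁ + 4/3) + (β²/96)S₃ − (3/16)β·Σ'T`. [folklore] -/
theorem integral_trace_sub_eq_su3 (hL : (1 : ZMod L) ≠ 0) (β : ℝ) (x : Site d L) {μ ν₀ : Fin d} (hμν₀ : μ ≠ ν₀) :
    (∫ U, (fundamentalRep (Fin 3) (wordHolonomy U x (plaqWord μ ν₀ true))).trace
        ∂(wilsonMeasure (d := d) (L := L) (fundamentalRep (Fin 3)) β)) - β / 2 - β ^ 2 / 8 =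
      (3 / 10 * β : ℂ) * ((∫ U, (fundamentalRep (Fin 3) (wordHolonomy U x (plaqWord μ ν₀ true).reverse)).trace
          ∂(wilsonMeasure (d := d) (L := L) (fundamentalRep (Fin 3)) β)) - β / 2) +
      (3 / 160 * β ^ 2 : ℂ) * ((∑ ν ∈ Finset.univ.erase μ, ∑ ε : Bool,
          ∫ U, plaqTerm (fundamentalRep (Fin 3)) 1 x μ U (plaqWord μ ν₀ true) ν ε *
            (fundamentalRep (Fin 3) (wordHolonomy U x (plaqWord μ ν₀ true))).trace
              ∂(wilsonMeasure (d := d) (L := L) (fundamentalRep (Fin 3)) β)) + 4 / 3) +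
      (β ^ 2 / 96 : ℂ) * (∑ ν ∈ Finset.univ.erase μ, ∑ ε : Bool,
          ∫ U, plaqTerm (fundamentalRep (Fin 3)) 1 x μ U (plaqWord μ ν₀ true) ν ε *
            (fundamentalRep (Fin 3) (wordHolonomy U x (plaqWord μ ν₀ true).reverse)).trace
              ∂(wilsonMeasure (d := d) (L := L) (fundamentalRep (Fin 3)) β)) -
      (3 / 16 * β : ℂ) * (∑ ν ∈ (Finset.univ.erase μ).erase ν₀,
            ∫ U, plaqTerm (fundamentalRep (Fin 3)) 1 x μ U (plaqWord μ ν₀ true) ν true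
              ∂(wilsonMeasure (d := d) (L := L) (fundamentalRep (Fin 3)) β) +
          ∑ ν ∈ Finset.univ.erase μ,
            ∫ U, plaqTerm (fundamentalRep (Fin 3)) 1 x μ U (plaqWord μ ν₀ true) ν false
              ∂(wilsonMeasure (d := d) (L := L) (fundamentalRep (Fin 3)) β)) := by
  haveI := isProbabilityMeasure_wilsonMeasure (d := d) (L := L) (fundamentalRep (Fin 3)) (continuous_fundamentalRep (Fin 3)) β
  have hP : Word.endpoint x (plaqWord μ ν₀ true) = x := endpoint_plaqWord x μ ν₀ true
  have hν₀ : ν₀ ∈ Finset.univ.erase μ := Finset.mem_erase.2 ⟨fun h => hμν₀ h.symm, Finset.mem_univ _⟩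
  have hc : ∀ u : Word d, Continuous fun U : GaugeConfig d L (Matrix.specialUnitaryGroup (Fin 3) ℂ) =>
      (fundamentalRep (Fin 3) (wordHolonomy U x u)).trace := fun u => continuous_trace_wordHolonomy (fundamentalLatticeRep 3) x u
  -- (Eq0) the plaquette loop equation, split at `(ν₀, +)`
  have h0 := Equipartition.loopEquation_plaqWord (d := d) (L := L) (fundamentalLatticeRep 3) hL β x hμν₀ true 1
    fun i j => sdPair_specialUnitaryGroup 3 β x μ x _ _ (trace_unitDir_one i j)
  simp only [fundamentalLatticeRep_N, fundamentalLatticeRep_ρ, Nat.cast_ofNat] at h0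
  have h0' : ((3 : ℂ) - 1 / 3) * (∫ U, (fundamentalRep (Fin 3) (wordHolonomy U x (plaqWord μ ν₀ true))).trace
      ∂(wilsonMeasure (d := d) (L := L) (fundamentalRep (Fin 3)) β)) +
      (β / 2 : ℂ) * ∑ ν ∈ Finset.univ.erase μ, ∑ ε : Bool,
        ∫ U, plaqTerm (fundamentalRep (Fin 3)) 1 x μ U (plaqWord μ ν₀ true) ν ε
          ∂(wilsonMeasure (d := d) (L := L) (fundamentalRep (Fin 3)) β) = 0 := h0
  rw [sum_sum_eq_add hν₀] at h0'
  -- the `(ν₀, +)` term `T₀ = b − 3 − (a − m)/3`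
  have hT₀ := integral_plaqTerm_latticeRep (d := d) (L := L) (fundamentalLatticeRep 3) β 1 x μ (plaqWord μ ν₀ true) ν₀ true
  simp only [fundamentalLatticeRep_N, fundamentalLatticeRep_ρ, Nat.cast_ofNat] at hT₀
  have hT₀' : ∫ U, plaqTerm (fundamentalRep (Fin 3)) 1 x μ U (plaqWord μ ν₀ true) ν₀ true
      ∂(wilsonMeasure (d := d) (L := L) (fundamentalRep (Fin 3)) β) =
      (∫ U, (fundamentalRep (Fin 3) (wordHolonomy U x (plaqWord μ ν₀ true ++ plaqWord μ ν₀ true))).trace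
          ∂(wilsonMeasure (d := d) (L := L) (fundamentalRep (Fin 3)) β)) -
        (∫ U, (fundamentalRep (Fin 3) (wordHolonomy U x (plaqWord μ ν₀ true ++ (plaqWord μ ν₀ true).reverse))).trace
          ∂(wilsonMeasure (d := d) (L := L) (fundamentalRep (Fin 3)) β)) -
        1 / (3 : ℂ) * ((∫ U, (fundamentalRep (Fin 3) (wordHolonomy U x (plaqWord μ ν₀ true))).trace *
            (fundamentalRep (Fin 3) (wordHolonomy U x (plaqWord μ ν₀ true))).trace
              ∂(wilsonMeasure (d := d) (L := L) (fundamentalRep (Fin 3)) β)) -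
          ∫ U, (fundamentalRep (Fin 3) (wordHolonomy U x (plaqWord μ ν₀ true))).trace *
            (fundamentalRep (Fin 3) (wordHolonomy U x (plaqWord μ ν₀ true).reverse)).trace
              ∂(wilsonMeasure (d := d) (L := L) (fundamentalRep (Fin 3)) β)) := hT₀
  have htriv : ∫ U, (fundamentalRep (Fin 3) (wordHolonomy U x (plaqWord μ ν₀ true ++ (plaqWord μ ν₀ true).reverse))).trace
      ∂(wilsonMeasure (d := d) (L := L) (fundamentalRep (Fin 3)) β) = 3 := by
    simp_rw [trace_plaqWord_append_reverse_su3]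
    rw [integral_const, probReal_univ, one_smul]
  rw [hT₀', htriv] at h0'
  -- (Eq1), (Eq2) the spectator identities
  have h1 := spectator_self_identity (d := d) (L := L) (fundamentalLatticeRep 3) hL β x hμν₀ 1
    fun i j => sdPair₂_specialUnitaryGroup 3 β x μ x _ x _ _ (trace_unitDir_one i j)
  have h2 := spectator_reverse_identity (d := d) (L := L) (fundamentalLatticeRep 3) hL β x hμν₀ 1
    fun i j => sdPair₂_specialUnitaryGroup 3 β x μ x _ x _ _ (trace_unitDir_one i j)
  simp only [fundamentalLatticeRep_N, fundamentalLatticeRep_ρ, Nat.cast_ofNat] at h1 h2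
  have h1' : ((3 : ℂ) - 2 * 1 / 3) * (∫ U, (fundamentalRep (Fin 3) (wordHolonomy U x (plaqWord μ ν₀ true))).trace *
      (fundamentalRep (Fin 3) (wordHolonomy U x (plaqWord μ ν₀ true))).trace ∂(wilsonMeasure (d := d) (L := L) (fundamentalRep (Fin 3)) β)) +
      (∫ U, (fundamentalRep (Fin 3) (wordHolonomy U x (plaqWord μ ν₀ true ++ plaqWord μ ν₀ true))).trace
        ∂(wilsonMeasure (d := d) (L := L) (fundamentalRep (Fin 3)) β)) =
      -((β / 2 : ℂ) * ∑ ν ∈ Finset.univ.erase μ, ∑ ε : Bool,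
        ∫ U, plaqTerm (fundamentalRep (Fin 3)) 1 x μ U (plaqWord μ ν₀ true) ν ε *
          (fundamentalRep (Fin 3) (wordHolonomy U x (plaqWord μ ν₀ true))).trace
            ∂(wilsonMeasure (d := d) (L := L) (fundamentalRep (Fin 3)) β)) := h1
  have h2' : (3 : ℂ) * (∫ U, (fundamentalRep (Fin 3) (wordHolonomy U x (plaqWord μ ν₀ true))).trace *
      (fundamentalRep (Fin 3) (wordHolonomy U x (plaqWord μ ν₀ true).reverse)).trace
        ∂(wilsonMeasure (d := d) (L := L) (fundamentalRep (Fin 3)) β)) - 3 =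
      -((β / 2 : ℂ) * ∑ ν ∈ Finset.univ.erase μ, ∑ ε : Bool,
        ∫ U, plaqTerm (fundamentalRep (Fin 3)) 1 x μ U (plaqWord μ ν₀ true) ν ε *
          (fundamentalRep (Fin 3) (wordHolonomy U x (plaqWord μ ν₀ true).reverse)).trace
            ∂(wilsonMeasure (d := d) (L := L) (fundamentalRep (Fin 3)) β)) := h2
  -- (Eq3) Cayley–Hamilton integrated: `b = a − 2τ̄`
  have hiA : Integrable (fun U : GaugeConfig d L (Matrix.specialUnitaryGroup (Fin 3) ℂ) =>
      (fundamentalRep (Fin 3) (wordHolonomy U x (plaqWord μ ν₀ true))).trace *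
        (fundamentalRep (Fin 3) (wordHolonomy U x (plaqWord μ ν₀ true))).trace)
      (wilsonMeasure (d := d) (L := L) (fundamentalRep (Fin 3)) β) := integrable_of_continuous (fundamentalLatticeRep 3) β ((hc _).mul (hc _))
  have hiT : Integrable (fun U : GaugeConfig d L (Matrix.specialUnitaryGroup (Fin 3) ℂ) =>
      (fundamentalRep (Fin 3) (wordHolonomy U x (plaqWord μ ν₀ true).reverse)).trace)
      (wilsonMeasure (d := d) (L := L) (fundamentalRep (Fin 3)) β) := integrable_of_continuous (fundamentalLatticeRep 3) β (hc _)
  have h3 : ∫ U, (fundamentalRep (Fin 3) (wordHolonomy U x (plaqWord μ ν₀ true ++ plaqWord μ ν₀ true))).trace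
      ∂(wilsonMeasure (d := d) (L := L) (fundamentalRep (Fin 3)) β) =
      (∫ U, (fundamentalRep (Fin 3) (wordHolonomy U x (plaqWord μ ν₀ true))).trace *
          (fundamentalRep (Fin 3) (wordHolonomy U x (plaqWord μ ν₀ true))).trace
            ∂(wilsonMeasure (d := d) (L := L) (fundamentalRep (Fin 3)) β)) -
        2 * ∫ U, (fundamentalRep (Fin 3) (wordHolonomy U x (plaqWord μ ν₀ true).reverse)).trace
            ∂(wilsonMeasure (d := d) (L := L) (fundamentalRep (Fin 3)) β) := by
    simp_rw [su3_trace_append_self _ x _ hP]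
    rw [integral_sub hiA (hiT.const_mul _), integral_const_mul]
  rw [h3] at h0' h1'
  linear_combination (3 / 8 : ℂ) * h0' + (-(3 * (β : ℂ) / 80)) * h1' + (-(β : ℂ) / 48) * h2'

/-! ## The third-order bound -/

/-- ★★★ **THE `SU(3)` PLAQUETTE AT STRONG COUPLING THROUGH THIRD ORDER.**  For `d ≥ 2`, every torus side `L ≥ 2` and
EVERY real (tree) coupling `β` (`= β_std/3`):
`|⟨ū_P⟩_{β,L} − β/6 − β²/24| ≤ (27/8)·d²(d−1)·|β|³`.
Three loop-equation steps closed by `|tr| ≤ 3` and the `SU(3)` Cayley–Hamilton identities; uniform in the volume.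
[folklore] -/
theorem abs_wilsonExpectation_meanPlaquette_su3_third_le (hL : (1 : ZMod L) ≠ 0) (hd : 2 ≤ d) (β : ℝ) :
    |wilsonExpectation (fundamentalRep (Fin 3)) β
        (meanPlaquette (d := d) (L := L) (G := Matrix.specialUnitaryGroup (Fin 3) ℂ) (fundamentalRep (Fin 3))) -
        β / 6 - β ^ 2 / 24| ≤ 27 / 8 * (d : ℝ) ^ 2 * ((d : ℝ) - 1) * |β| ^ 3 := by
  obtain ⟨μ, ν₀, hμν₀⟩ : ∃ μ ν₀ : Fin d, μ ≠ ν₀ := ⟨⟨0, by omega⟩, ⟨1, by omega⟩, by simp [Fin.ext_iff]⟩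
  have hν₀μ : ν₀ ≠ μ := fun h => hμν₀ h.symm
  have hd2 : (2 : ℝ) ≤ d := by exact_mod_cast hd
  have hd1 : (1 : ℝ) ≤ (d : ℝ) - 1 := by linarith
  set x : Site d L := fun _ => 0 with hx
  set W := wilsonExpectation (fundamentalRep (Fin 3)) β
    (meanPlaquette (d := d) (L := L) (G := Matrix.specialUnitaryGroup (Fin 3) ℂ) (fundamentalRep (Fin 3))) with hW
  -- the exact identity
  have hid := integral_trace_sub_eq_su3 (d := d) (L := L) hL β x hμν₀
  -- real parts: `Re τ = 3W = Re τ̄`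
  have hre : ∀ {κ₁ κ₂ : Fin d} (h : κ₁ ≠ κ₂), (∫ U, (fundamentalRep (Fin 3) (wordHolonomy U x (plaqWord κ₁ κ₂ true))).trace
      ∂(wilsonMeasure (d := d) (L := L) (fundamentalRep (Fin 3)) β)).re = 3 * W := by
    intro κ₁ κ₂ h
    have h1 := Equipartition.integral_re_trace_plaqWord (d := d) (L := L) (fundamentalLatticeRep 3) β x h true (by norm_num)
    have h2 := Equipartition.re_integral_eq (fundamentalLatticeRep 3) β
      (continuous_trace_wordHolonomy (fundamentalLatticeRep 3) x (plaqWord κ₁ κ₂ true))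
    simp only [fundamentalLatticeRep_N, fundamentalLatticeRep_ρ, Nat.cast_ofNat] at h1 h2
    rw [← h2] at h1
    exact h1
  have hreτ := hre hμν₀
  have hreτ' : (∫ U, (fundamentalRep (Fin 3) (wordHolonomy U x (plaqWord μ ν₀ true).reverse)).trace
      ∂(wilsonMeasure (d := d) (L := L) (fundamentalRep (Fin 3)) β)).re = 3 * W := by
    rw [show (plaqWord μ ν₀ true).reverse = plaqWord ν₀ μ true from rfl]; exact hre hν₀μ
  -- the four bounds
  have hB1 := norm_selfSpectatorSum_add_le (d := d) (L := L) hL β x hμν₀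
  have hB3 := norm_reverseSpectatorSum_le (d := d) (L := L) hL β x hμν₀
  have hBT := norm_offDiagonal_le hμν₀
    (fun ν ε => ∫ U, plaqTerm (fundamentalRep (Fin 3)) 1 x μ U (plaqWord μ ν₀ true) ν ε
      ∂(wilsonMeasure (d := d) (L := L) (fundamentalRep (Fin 3)) β)) (B := 27 * ((d : ℝ) - 1) ^ 2 * β ^ 2)
    (fun ν hν => by
      obtain ⟨hνν₀, hν'⟩ := Finset.mem_erase.1 hν
      have hνμ : ν ≠ μ := (Finset.mem_erase.1 hν').1
      have h := integral_plaqTerm_latticeRep (d := d) (L := L) (fundamentalLatticeRep 3) β 1 x μ (plaqWord μ ν₀ true) ν true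
      simp only [fundamentalLatticeRep_N, fundamentalLatticeRep_ρ, Nat.cast_ofNat] at h
      have hb := norm_plaqTermIntegral_le₂ (d := d) (L := L) (N := 3) (by norm_num) hL β x hμν₀ hνμ (ε := true)
        (fun h' => hνν₀ h'.1)
      simp only [Nat.cast_ofNat] at hb
      rw [h]; exact hb.trans (le_of_eq (by ring)))
    (fun ν hν => by
      have hνμ : ν ≠ μ := (Finset.mem_erase.1 hν).1
      have h := integral_plaqTerm_latticeRep (d := d) (L := L) (fundamentalLatticeRep 3) β 1 x μ (plaqWord μ ν₀ true) ν false
      simp only [fundamentalLatticeRep_N, fundamentalLatticeRep_ρ, Nat.cast_ofNat] at h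
      have hb := norm_plaqTermIntegral_le₂ (d := d) (L := L) (N := 3) (by norm_num) hL β x hμν₀ hνμ (ε := false)
        (fun h' => Bool.false_ne_true h'.2)
      simp only [Nat.cast_ofNat] at hb
      rw [h]; exact hb.trans (le_of_eq (by ring)))
  have hW2 := abs_wilsonExpectation_meanPlaquette_sub_suN_le (d := d) (L := L) (N := 3) le_rfl hL hd β
  rw [← hW] at hW2
  simp only [Nat.cast_ofNat] at hW2
  rw [show β / (2 * 3) = β / 6 by norm_num] at hW2
  -- abbreviations and the exact identity in short form
  set Z₁ := (∑ ν ∈ Finset.univ.erase μ, ∑ ε : Bool,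
      ∫ U, plaqTerm (fundamentalRep (Fin 3)) 1 x μ U (plaqWord μ ν₀ true) ν ε *
        (fundamentalRep (Fin 3) (wordHolonomy U x (plaqWord μ ν₀ true))).trace
          ∂(wilsonMeasure (d := d) (L := L) (fundamentalRep (Fin 3)) β)) + 4 / 3 with hZ₁
  set Z₃ := ∑ ν ∈ Finset.univ.erase μ, ∑ ε : Bool,
      ∫ U, plaqTerm (fundamentalRep (Fin 3)) 1 x μ U (plaqWord μ ν₀ true) ν ε *
        (fundamentalRep (Fin 3) (wordHolonomy U x (plaqWord μ ν₀ true).reverse)).trace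
          ∂(wilsonMeasure (d := d) (L := L) (fundamentalRep (Fin 3)) β) with hZ₃
  set ZT := ∑ ν ∈ (Finset.univ.erase μ).erase ν₀,
        ∫ U, plaqTerm (fundamentalRep (Fin 3)) 1 x μ U (plaqWord μ ν₀ true) ν true
          ∂(wilsonMeasure (d := d) (L := L) (fundamentalRep (Fin 3)) β) +
      ∑ ν ∈ Finset.univ.erase μ,
        ∫ U, plaqTerm (fundamentalRep (Fin 3)) 1 x μ U (plaqWord μ ν₀ true) ν false
          ∂(wilsonMeasure (d := d) (L := L) (fundamentalRep (Fin 3)) β) with hZT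
  set τ := ∫ U, (fundamentalRep (Fin 3) (wordHolonomy U x (plaqWord μ ν₀ true))).trace
    ∂(wilsonMeasure (d := d) (L := L) (fundamentalRep (Fin 3)) β) with hτ
  set τ' := ∫ U, (fundamentalRep (Fin 3) (wordHolonomy U x (plaqWord μ ν₀ true).reverse)).trace
    ∂(wilsonMeasure (d := d) (L := L) (fundamentalRep (Fin 3)) β) with hτ'
  have hid' : τ - β / 2 - β ^ 2 / 8 - (3 / 10 * β : ℂ) * (τ' - β / 2) =
      (3 / 160 * β ^ 2 : ℂ) * Z₁ + (β ^ 2 / 96 : ℂ) * Z₃ - (3 / 16 * β : ℂ) * ZT := by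
    rw [hid]; ring
  have hR : ‖(3 / 160 * β ^ 2 : ℂ) * Z₁ + (β ^ 2 / 96 : ℂ) * Z₃ - (3 / 16 * β : ℂ) * ZT‖ ≤
      3 / 160 * β ^ 2 * ((103 + 54 * (2 * (d : ℝ) - 3)) * ((d : ℝ) - 1) * |β|) +
        β ^ 2 / 96 * ((143 + 54 * (2 * (d : ℝ) - 3)) * ((d : ℝ) - 1) * |β|) +
        3 / 16 * |β| * ((2 * (d : ℝ) - 3) * (27 * ((d : ℝ) - 1) ^ 2 * β ^ 2)) := by
    have n1 : ‖(3 / 160 * β ^ 2 : ℂ)‖ = 3 / 160 * β ^ 2 := by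
      rw [show (3 / 160 * β ^ 2 : ℂ) = ((3 / 160 * β ^ 2 : ℝ) : ℂ) by push_cast; ring, Complex.norm_real, Real.norm_eq_abs,
        abs_of_nonneg (by positivity)]
    have n2 : ‖(β ^ 2 / 96 : ℂ)‖ = β ^ 2 / 96 := by
      rw [show (β ^ 2 / 96 : ℂ) = ((β ^ 2 / 96 : ℝ) : ℂ) by push_cast; ring, Complex.norm_real, Real.norm_eq_abs,
        abs_of_nonneg (by positivity)]
    have n3 : ‖(3 / 16 * β : ℂ)‖ = 3 / 16 * |β| := by
      rw [show (3 / 16 * β : ℂ) = ((3 / 16 * β : ℝ) : ℂ) by push_cast; ring, Complex.norm_real, Real.norm_eq_abs, abs_mul,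
        abs_of_nonneg (by norm_num : (0 : ℝ) ≤ 3 / 16)]
    refine (norm_sub_le _ _).trans (add_le_add ((norm_add_le _ _).trans (add_le_add ?_ ?_)) ?_)
    · rw [norm_mul, n1]; exact mul_le_mul_of_nonneg_left hB1 (by positivity)
    · rw [norm_mul, n2]; exact mul_le_mul_of_nonneg_left hB3 (by positivity)
    · rw [norm_mul, n3]; exact mul_le_mul_of_nonneg_left hBT (by positivity)
  -- the real part of the left side
  have e1 : (3 / 10 * β : ℂ) = ((3 / 10 * β : ℝ) : ℂ) := by push_cast; ring
  have e2 : ((β : ℂ) / 2) = ((β / 2 : ℝ) : ℂ) := by push_cast; ring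
  have e3 : ((β : ℂ) ^ 2 / 8) = ((β ^ 2 / 8 : ℝ) : ℂ) := by push_cast; ring
  have hreL : (τ - β / 2 - β ^ 2 / 8 - (3 / 10 * β : ℂ) * (τ' - β / 2)).re =
      3 * (W - β / 6 - β ^ 2 / 24) - 3 / 10 * β * (3 * (W - β / 6)) := by
    rw [e1, e2, e3]
    simp only [Complex.sub_re, Complex.ofReal_re, Complex.re_ofReal_mul, hreτ, hreτ']
    ring
  have hreR : |3 * (W - β / 6 - β ^ 2 / 24) - 3 / 10 * β * (3 * (W - β / 6))| ≤
      ‖(3 / 160 * β ^ 2 : ℂ) * Z₁ + (β ^ 2 / 96 : ℂ) * Z₃ - (3 / 16 * β : ℂ) * ZT‖ := by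
    rw [← hreL, hid']; exact Complex.abs_re_le_norm _
  -- assemble
  have hτ2 : |3 / 10 * β * (3 * (W - β / 6))| ≤ 3 / 10 * |β| * (3 * (2 * ((d : ℝ) - 1) * β ^ 2 / ((3 : ℝ) ^ 2 - 1) *
      (1 + 4 * (3 : ℝ) ^ 4 / (((3 : ℝ) ^ 2 - 1) * ((3 : ℝ) ^ 2 - 4)) + 4 * (2 * (d : ℝ) - 3) * (3 : ℝ) ^ 2 / ((3 : ℝ) ^ 2 - 1)))) := by
    rw [abs_mul, abs_mul, abs_of_nonneg (by norm_num : (0 : ℝ) ≤ 3 / 10), abs_mul, abs_of_nonneg (by norm_num : (0 : ℝ) ≤ 3)]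
    refine mul_le_mul_of_nonneg_left (mul_le_mul_of_nonneg_left ?_ (by norm_num)) (by positivity)
    refine hW2.trans (le_of_eq ?_)
    ring
  have hmain : 3 * |W - β / 6 - β ^ 2 / 24| ≤
      3 / 10 * |β| * (3 * (2 * ((d : ℝ) - 1) * β ^ 2 / ((3 : ℝ) ^ 2 - 1) *
        (1 + 4 * (3 : ℝ) ^ 4 / (((3 : ℝ) ^ 2 - 1) * ((3 : ℝ) ^ 2 - 4)) + 4 * (2 * (d : ℝ) - 3) * (3 : ℝ) ^ 2 / ((3 : ℝ) ^ 2 - 1)))) +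
      (3 / 160 * β ^ 2 * ((103 + 54 * (2 * (d : ℝ) - 3)) * ((d : ℝ) - 1) * |β|) +
        β ^ 2 / 96 * ((143 + 54 * (2 * (d : ℝ) - 3)) * ((d : ℝ) - 1) * |β|) +
        3 / 16 * |β| * ((2 * (d : ℝ) - 3) * (27 * ((d : ℝ) - 1) ^ 2 * β ^ 2))) := by
    have h := abs_sub_abs_le_abs_sub (3 * (W - β / 6 - β ^ 2 / 24)) (3 / 10 * β * (3 * (W - β / 6)))
    rw [abs_mul, abs_of_pos (by norm_num : (0 : ℝ) < 3)] at h
    linarith [hreR.trans hR]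
  have hb0 : 0 ≤ |β| := abs_nonneg β
  have hb3 : |β| ^ 3 = |β| * β ^ 2 := by rw [pow_succ', sq_abs]
  -- the polynomial in `d`
  have hRHS : 3 / 10 * |β| * (3 * (2 * ((d : ℝ) - 1) * β ^ 2 / ((3 : ℝ) ^ 2 - 1) *
        (1 + 4 * (3 : ℝ) ^ 4 / (((3 : ℝ) ^ 2 - 1) * ((3 : ℝ) ^ 2 - 4)) + 4 * (2 * (d : ℝ) - 3) * (3 : ℝ) ^ 2 / ((3 : ℝ) ^ 2 - 1)))) +
      (3 / 160 * β ^ 2 * ((103 + 54 * (2 * (d : ℝ) - 3)) * ((d : ℝ) - 1) * |β|) +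
        β ^ 2 / 96 * ((143 + 54 * (2 * (d : ℝ) - 3)) * ((d : ℝ) - 1) * |β|) +
        3 / 16 * |β| * ((2 * (d : ℝ) - 3) * (27 * ((d : ℝ) - 1) ^ 2 * β ^ 2))) =
      ((d : ℝ) - 1) * (|β| * β ^ 2) * (9 / 40 * (9 * (d : ℝ) - 22 / 5) + 3 / 160 * (108 * (d : ℝ) - 59) +
        1 / 96 * (108 * (d : ℝ) - 19) + 81 / 16 * ((2 * (d : ℝ) - 3) * ((d : ℝ) - 1))) := by
    ring
  have hbr : 9 / 40 * (9 * (d : ℝ) - 22 / 5) + 3 / 160 * (108 * (d : ℝ) - 59) + 1 / 96 * (108 * (d : ℝ) - 19) +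
      81 / 16 * ((2 * (d : ℝ) - 3) * ((d : ℝ) - 1)) ≤ 81 / 8 * (d : ℝ) ^ 2 := by
    nlinarith
  rw [hRHS] at hmain
  rw [hb3]
  have hX : 0 ≤ ((d : ℝ) - 1) * (|β| * β ^ 2) := by positivity
  have hfin := mul_le_mul_of_nonneg_left hbr hX
  have hgoal : 27 / 8 * (d : ℝ) ^ 2 * ((d : ℝ) - 1) * (|β| * β ^ 2) =
      (((d : ℝ) - 1) * (|β| * β ^ 2) * (81 / 8 * (d : ℝ) ^ 2)) / 3 := by ring
  rw [hgoal, le_div_iff₀ (by norm_num : (0 : ℝ) < 3), mul_comm]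
  exact hmain.trans hfin

/-! ## The cell's form -/

/-- ★★★ **The cell's form, third order** (`SU(3)`, `D ≥ 2`, every `L ≥ 2`, every real `β_std`):
`|plaquetteExpectation 3 D L β_std − β_std/18 − β_std²/216| ≤ D²(D−1)·|β_std|³/8` — the second strong-coupling coefficient
`1/216` of the `SU(3)` plaquette with an explicit, volume-uniform remainder. [folklore] -/
theorem abs_plaquetteExpectation_su3_third_le {D L : ℕ} [NeZero L] (hL : 2 ≤ L) (hD : 2 ≤ D) (β : ℝ) :
    |plaquetteExpectation 3 D L β - β / 18 - β ^ 2 / 216| ≤ (D : ℝ) ^ 2 * ((D : ℝ) - 1) * |β| ^ 3 / 8 := by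
  have h := abs_wilsonExpectation_meanPlaquette_su3_third_le (d := D) (L := L) (zmod_one_ne_zero hL) hD (β / 3)
  unfold plaquetteExpectation
  have e1 : β / (3 : ℕ) = β / 3 := by norm_num
  rw [e1]
  have e2 : β / 3 / 6 = β / 18 := by ring
  have e3 : (β / 3) ^ 2 / 24 = β ^ 2 / 216 := by ring
  rw [e2, e3] at h
  refine h.trans (le_of_eq ?_)
  rw [abs_div, abs_of_pos (by norm_num : (0 : ℝ) < 3)]
  ring

/-- `T4` (`SU(3)`, `D = 4`): `|plaquetteExpectation 3 4 L β_std − β_std/18 − β_std²/216| ≤ 6·|β_std|³` for every `L ≥ 2` and every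
real `β_std`. [folklore] -/
theorem abs_plaquetteExpectation_three_four_third_le {L : ℕ} [NeZero L] (hL : 2 ≤ L) (β : ℝ) :
    |plaquetteExpectation 3 4 L β - β / 18 - β ^ 2 / 216| ≤ 6 * |β| ^ 3 := by
  have h := abs_plaquetteExpectation_su3_third_le (D := 4) (L := L) hL (by norm_num) β
  norm_num at h
  linarith

/-- `T3` (`SU(3)`, `D = 3`): `|plaquetteExpectation 3 3 L β_std − β_std/18 − β_std²/216| ≤ 9·|β_std|³/4`. [folklore] -/
theorem abs_plaquetteExpectation_three_three_third_le {L : ℕ} [NeZero L] (hL : 2 ≤ L) (β : ℝ) :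
    |plaquetteExpectation 3 3 L β - β / 18 - β ^ 2 / 216| ≤ 9 * |β| ^ 3 / 4 := by
  have h := abs_plaquetteExpectation_su3_third_le (D := 3) (L := L) hL (by norm_num) β
  norm_num at h
  linarith

end StrongCoupling

end Summit.QuantumFields.GaugeBoot

end
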